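import Literature.Probability.Percolation.ArmSeparationRotate
import HarnessLib

/-!
# Outer separation of two arms: fenced tips and compatibility of their free spaces

Topic: Probability / Percolation; family `crit-perc`. The deterministic half of Kesten's
separation step for the two-arm event `armEvent ![true,false] n (2M)` on the hexagonal annulus
`Λ_{2M} ∖ Λ_n` (Nolin 2008, §4.4, proof of Thm. 11 [arXiv 0711.4948: Thm. 10], first step:
`A_{j,σ}(2^k,2^K) ⊆ Ã^{·/η'}(2^k,2^K) ∪ ({one of the U-shaped regions fails} ∩ A(2^k,2^{K-1}))`),
for `j = 2`, `σ = BW`: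

* `TrapFencedArm M n k₀ K χ` — the data of a **fenced arm behind side `0`** of `∂Λ_{2M}` in the
  configuration `χ` (colour = `χ`-open): a tip `z ∈ trapO M`, a scale `k = k₀ · 32^j`, `j < K`, a
  fenced protected tip (`TrapTipOK`: an open vertical crossing of the corner box through `m`,
  protection from above at scale `8k`), an open path of the annulus continued through the fence
  zone to `m`, and an open path of the annulus to the tip, both from a site `a` of norm `n`.
* `exists_trapFencedArm` — from `trap_reroute`: if the exploration sequence of `χ` stops before
  `T` and no term fails, every `χ`-open path of the annulus from norm `n` to `trapO` is fenced.
* `OutFail M T k₀ K χ` (`lowestSeq χ T ≠ none ∨ ∃ u < T, TrapSeqFail M u k₀ K χ`) and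
  `exists_two_trapFencedArm` — **on the two-arm event, if none of the twelve rotated / colour
  exchanged configurations `rotConfig i ω`, `(rotConfig i ω)ᶜ` (`i < 6`) fails, the open arm is
  fenced in some `rotConfig io ω` and the closed arm in some `(rotConfig ic ω)ᶜ`.**
* **Compatibility** — the free spaces of the two arms use disjoint sets of sites outside
  `Λ_{2M}`: with `extRegion` the exterior part of the fence zone together with the corner box
  (exterior sites strictly above the tip's row in the square of half-width `2k+1`), and the
  relative rotation `d` of the two frames,
  `Disjoint extRegion(open) (ρ^d '' extRegion(closed))`: for `d = 0` the rows separate once the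
  tips are `8k` apart, which the protection of the HIGHER tip enforces (`compatible_same`); for
  `d = 1` (closed arm on the next side counterclockwise) the protection of the open tip keeps the
  closed tip off the corner box or far below (`compatible_adj`, by the explicit rotation
  `ρ(x, y) = (-y, x + y)`), `d = 5` being the same with the roles exchanged; for `d ∈ {2,3,4}`
  the two squares are far apart (`compatible_far`). Assembled in `disjoint_extRegion_image`.
  This is what the locally monotone FKG inequality (`LocallyMonotoneFKG.lean`, Nolin's Lemma 13)
  needs to extend the two arms independently in the next annulus.

## References

* P. Nolin, *Near-critical percolation in two dimensions*, Electron. J. Probab. 13 (2008), §4.2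
  (well-separateness), §4.4 (proof of Thm. 11) [arXiv 0711.4948: Def. 6–8, Thm. 10]. [Nolin2008]
* H. Kesten, *Scaling relations for 2D-percolation*, Comm. Math. Phys. 109 (1987), Lemma 2. [Kesten1987]
-/

noncomputable section

open Set

namespace Literature.Probability.Percolation

open LatticeModels

/-! ### Fenced arms -/

/-- **A fenced arm behind side `0` of `∂Λ_{2M}`** in the configuration `χ` (Nolin 2008, §4.2,
Def. 6–8, the data `(z_i, r_i, c̃_i)` of a well-separated arm with its free space, for one arm):
a tip `z ∈ trapO M`, a scale index `j < K` (scale `k = k₀ · 32^j`), a fenced protected tip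
`TrapTipOK M z k χ m`, a `χ`-open path of the annulus `{n ≤ |v| ≤ 2M}` continued through the
fence zone `trapFrameZone M z k` from a site `a` of norm `n` to `m`, and a `χ`-open path of the
annulus from `a` to the tip `z`. [cite: Nolin2008, §4.2 Def. 6–8 (arXiv 0711.4948)] -/
structure TrapFencedArm (M n k₀ K : ℕ) (χ : SiteConfig (Site 2)) where
  /-- the tip -/
  z : Site 2
  /-- the scale index -/
  j : ℕ
  /-- the site of the fence through which the vertical crossing passes -/
  m : Site 2
  /-- the start of the arm, a site of norm `n` -/
  a : Site 2
  z_mem : z ∈ trapO M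
  j_lt : j < K
  norm_a : triNorm a = n
  tipOK : TrapTipOK M z (trapScale k₀ j) χ m
  path : PathIn triGraph ((triAnnSet n (2 * M) ∪ trapFrameZone M z (trapScale k₀ j)) ∩ χ) a m
  path_tip : PathIn triGraph (triAnnSet n (2 * M) ∩ χ) a z

namespace TrapFencedArm

variable {M n k₀ K : ℕ} {χ : SiteConfig (Site 2)}

/-- The scale of a fenced arm. [folklore] -/
def k (F : TrapFencedArm M n k₀ K χ) : ℕ := trapScale k₀ F.j

/-- **The exterior region of a fenced arm**: the sites outside `Λ_{2M}` strictly above the row of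
the tip in the square of half-width `2k + 1` about the tip — containing the exterior part of the
fence zone and the corner box of the fence. [cite: Nolin2008, §4.2 Def. 6 (free spaces) (arXiv 0711.4948)] -/
def extRegion (F : TrapFencedArm M n k₀ K χ) : Set (Site 2) :=
  {v | 2 * (M : ℤ) < triNorm v ∧ F.z 1 < v 1 ∧ F.z 0 - (2 * F.k + 1) ≤ v 0 ∧ v 0 ≤ F.z 0 + (2 * F.k + 1) ∧
    v 1 ≤ F.z 1 + (2 * F.k + 1)}

/-- Membership in the exterior region, unfolded. [folklore] -/
theorem mem_extRegion {F : TrapFencedArm M n k₀ K χ} {v : Site 2} :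
    v ∈ F.extRegion ↔ 2 * (M : ℤ) < triNorm v ∧ F.z 1 < v 1 ∧ F.z 0 - (2 * F.k + 1) ≤ v 0 ∧
      v 0 ≤ F.z 0 + (2 * F.k + 1) ∧ v 1 ≤ F.z 1 + (2 * F.k + 1) := Iff.rfl

/-- The exterior part of the fence zone lies in the exterior region. [folklore] -/
theorem mem_extRegion_of_mem_zone {F : TrapFencedArm M n k₀ K χ} {v : Site 2}
    (hv : v ∈ trapFrameZone M F.z F.k) (hn : 2 * (M : ℤ) < triNorm v) : v ∈ F.extRegion := by
  rw [mem_trapFrameZone] at hv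
  obtain ⟨h1, h2, h3, h4, h5⟩ := hv
  rcases h1 with h1 | h1
  · have := (mem_trapD_iff_triNorm.1 h1).2; omega
  · exact ⟨hn, h1.2, h2, h3, h5⟩

/-- The corner box of the fence lies in the exterior region. [folklore] -/
theorem mem_extRegion_of_mem_corner {F : TrapFencedArm M n k₀ K χ} {v : Site 2} (hk : 1 ≤ F.k)
    (hv : v ∈ triStrip (F.z 0 + F.k) (F.z 1 + F.k) F.k F.k) : v ∈ F.extRegion := by
  rw [mem_triStrip] at hv
  have hz := trapO_coord F.z_mem
  have hk' : (1 : ℤ) ≤ F.k := by exact_mod_cast hk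
  refine ⟨?_, by omega, by omega, by omega, by omega⟩
  rw [triNorm_eq_max]; simp only [lt_max_iff]; omega

/-- The tip of a fenced arm is an open site. [folklore] -/
theorem z_mem_config (F : TrapFencedArm M n k₀ K χ) : F.z ∈ χ := F.path_tip.right_mem.2

end TrapFencedArm

/-- **Fenced arms exist when nothing fails** (`trap_reroute`): if the exploration sequence of
`trapDomain M` in `χ` stops before `T` and no term `u < T` fails, every `χ`-open path of the
annulus from a site of norm `n ≤ M` to `trapO M` yields a fenced arm. [cite: Nolin2008, §4.4 Lemma 15 (proof) (arXiv 0711.4948: Lemma 14)] -/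
theorem exists_trapFencedArm {M n T k₀ K : ℕ} (hnM : n ≤ M) {χ : SiteConfig (Site 2)}
    (hT : (trapDomain M).lowestSeq χ T = none) (hOK : ∀ u < T, ¬ TrapSeqFail M u k₀ K χ)
    {a y : Site 2} (ha : triNorm a = n) (hy : y ∈ trapO M) (hp : PathIn triGraph (triAnnSet n (2 * M) ∩ χ) a y) :
    Nonempty (TrapFencedArm M n k₀ K χ) := by
  have ha0 : a 0 ≤ M := by
    have h1 : a 0 ≤ triNorm a := by rw [triNorm_eq_max]; simp only [le_max_iff]; exact Or.inl (Or.inl le_rfl)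
    have : (n : ℤ) ≤ M := by exact_mod_cast hnM
    omega
  obtain ⟨z, hz, j, hj, m, hOKm, hpath, htip⟩ := trap_reroute hnM hT hOK ha0 hy hp
  exact ⟨⟨z, j, m, a, hz, hj, ha, hOKm, hpath, htip⟩⟩

/-! ### The two-arm event: both arms fenced -/

/-- **Failure behind side `0`** for the colour `χ`-open: the exploration sequence of
`trapDomain M` in `χ` has a `T`-th term, or some term `u < T` fails on all scales. Its
probability is bounded in `ArmSeparationFenceBound.lean` (`real_trapSeparation_fail_le`). [cite: Nolin2008, §4.4 Lemma 15 (arXiv 0711.4948: Lemma 14)] -/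
def OutFail (M T k₀ K : ℕ) (χ : SiteConfig (Site 2)) : Prop :=
  (trapDomain M).lowestSeq χ T ≠ none ∨ ∃ u < T, TrapSeqFail M u k₀ K χ

/-- **Nothing fails around `∂Λ_{2M}`**: none of the twelve rotated / colour-exchanged
configurations `rotConfig i ω`, `(rotConfig i ω)ᶜ` (`i < 6`) fails behind side `0` (Nolin 2008,
§4.4: none of the U-shaped regions of the last annulus "fails", for either colour). [cite: Nolin2008, §4.4 (arXiv 0711.4948: proof of Thm. 10, first step)] -/
def OutGood (M T k₀ K : ℕ) (ω : SiteConfig (Site 2)) : Prop :=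
  ∀ i < 6, ¬ OutFail M T k₀ K (rotConfig i ω) ∧ ¬ OutFail M T k₀ K (rotConfig i ω)ᶜ

/-- **On the two-arm event, if nothing fails around `∂Λ_{2M}`, both arms are fenced**: the open
arm in some rotated frame `rotConfig io ω`, the closed arm (an open arm of the complement) in
some `(rotConfig ic ω)ᶜ` (`n ≤ M`, `1 ≤ M`). [cite: Nolin2008, §4.4 (arXiv 0711.4948: proof of Thm. 10, first step)] -/
theorem exists_two_trapFencedArm {M n T k₀ K : ℕ} (hM : 1 ≤ M) (hnM : n ≤ M) {ω : SiteConfig (Site 2)}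
    (hgood : OutGood M T k₀ K ω) (harm : ω ∈ armEvent ![true, false] n (2 * M)) :
    ∃ io < 6, ∃ ic < 6, Nonempty (TrapFencedArm M n k₀ K (rotConfig io ω)) ∧
      Nonempty (TrapFencedArm M n k₀ K (rotConfig ic ω)ᶜ) := by
  rw [armEvent_two_eq_inter] at harm
  obtain ⟨ho, hc⟩ := harm
  have hn2 : n ≤ 2 * M := by omega
  obtain ⟨io, hio, ao, yo, hao, hyo, hpo⟩ := exists_trapO_pathIn_rotConfig hM hn2 ho
  obtain ⟨ic, hic, ac, yc, hac, hyc, hpc⟩ := exists_trapO_pathIn_rotConfig hM hn2 hc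
  rw [setOf_mem_iff_true] at hpo
  rw [setOf_mem_iff_false] at hpc
  have unfail : ∀ χ : SiteConfig (Site 2), ¬ OutFail M T k₀ K χ →
      (trapDomain M).lowestSeq χ T = none ∧ ∀ u < T, ¬ TrapSeqFail M u k₀ K χ := by
    intro χ h
    simp only [OutFail, not_or, not_exists, not_and, ne_eq, not_not] at h
    exact h
  obtain ⟨hTo, hOKo⟩ := unfail _ (hgood io hio).1
  obtain ⟨hTc, hOKc⟩ := unfail _ (hgood ic hic).2
  exact ⟨io, hio, ic, hic, exists_trapFencedArm hnM hTo hOKo hao hyo hpo, exists_trapFencedArm hnM hTc hOKc hac hyc hpc⟩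

/-! ### Compatibility of the free spaces -/

section Compatibility

variable {M n k₀ K : ℕ}

/-- **Arms start far from the tip**: a `𝕋`-path of the annulus `{n ≤ |v| ≤ 2M}` of colour `ψ`
from a site `s` of the open box of half-width `16k` about a point `z` of the outer side to a
site `a` of norm `n ≤ M` contains a path of the trapezoid of colour `ψ` from `s` to a site outside
that open box (`16k < M`: inside the box the annulus is the trapezoid, and `a` is outside). [folklore] -/
theorem exists_pathIn_trapD_exit {z s a : Site 2} {k : ℕ} {ψ : Set (Site 2)} (hz : z ∈ trapO M) (hnM : n ≤ M)
    (hkM : 16 * (k : ℤ) < M) (ha : triNorm a = n)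
    (hs : z 0 - 16 * k < s 0 ∧ s 0 < z 0 + 16 * k ∧ z 1 - 16 * k < s 1 ∧ s 1 < z 1 + 16 * k)
    (hp : PathIn triGraph (triAnnSet n (2 * M) ∩ ψ) s a) :
    ∃ t : Site 2, (t 0 ≤ z 0 - 16 * k ∨ z 0 + 16 * k ≤ t 0 ∨ t 1 ≤ z 1 - 16 * k ∨ z 1 + 16 * k ≤ t 1) ∧
      PathIn triGraph ((↑(trapD M) : Set (Site 2)) ∩ ψ) s t := by
  have hz' := trapO_coord hz
  have hn' : (n : ℤ) ≤ M := by exact_mod_cast hnM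
  set R : Set (Site 2) := {v | z 0 - 16 * k < v 0 ∧ v 0 < z 0 + 16 * k ∧ z 1 - 16 * k < v 1 ∧ v 1 < z 1 + 16 * k}
    with hR
  have hsR : s ∈ R := hs
  have haR : a ∉ R := by
    intro h
    simp only [hR, Set.mem_setOf_eq] at h
    have h1 : a 0 ≤ triNorm a := by rw [triNorm_eq_max]; simp only [le_max_iff]; exact Or.inl (Or.inl le_rfl)
    omega
  obtain ⟨p, t, hpR, htR, htA, hpt, hsp⟩ := hp.exit hsR haR
  have hinT : ∀ v ∈ R ∩ (triAnnSet n (2 * M) ∩ ψ), v ∈ (↑(trapD M) : Set (Site 2)) ∩ ψ := by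
    rintro v ⟨hvR, hvA, hvψ⟩
    simp only [hR, Set.mem_setOf_eq] at hvR
    exact ⟨Finset.mem_coe.2 (mem_trapD_of_triNorm_le (by omega) hvA.2), hvψ⟩
  have hpR' := hpR
  simp only [hR, Set.mem_setOf_eq] at hpR' htR
  have ht0 := (triGraph_adj_coord hpt 0).1
  exact ⟨t, by omega, (hsp.mono hinT).tail hpt ⟨Finset.mem_coe.2 (mem_trapD_of_triNorm_le (by omega) htA.1.2), htA.2⟩⟩

/-- **Protection separates tips on the same side**: for a fenced arm of colour `χb` and a fenced
arm of a colour `χx` disjoint from `χb`, if the second tip lies strictly above the first then it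
is more than `8 k` above it (`k` the scale of the first arm): otherwise it is a top-type boundary
site of the inner box joined by a `χbᶜ`-path of the trapezoid to a far site, which the protection
clause of the first tip forbids. [cite: Nolin2008, §4.4 Lemma 15 (proof) (arXiv 0711.4948: Lemma 14)] -/
theorem row_gap_of_lt (hnM : n ≤ M) (hk₀ : 1 ≤ k₀) (hKM : ∀ j < K, 128 * (trapScale k₀ j : ℤ) < M)
    {χb χx : SiteConfig (Site 2)} (hcol : ∀ v, v ∈ χx → v ∉ χb)
    (Fb : TrapFencedArm M n k₀ K χb) (Fx : TrapFencedArm M n k₀ K χx)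
    (hlt : Fb.z 1 < Fx.z 1) : Fb.z 1 + 8 * Fb.k < Fx.z 1 := by
  by_contra hle
  rw [not_lt] at hle
  have hzb := trapO_coord Fb.z_mem
  have hzx := trapO_coord Fx.z_mem
  have hk1 : 1 ≤ trapScale k₀ Fb.j := one_le_trapScale hk₀ _
  have hkb : (Fb.k : ℤ) = trapScale k₀ Fb.j := rfl
  have hKb := hKM _ Fb.j_lt
  obtain ⟨t, ht, hpath⟩ := exists_pathIn_trapD_exit (k := 8 * trapScale k₀ Fb.j) Fb.z_mem hnM
    (by push_cast; omega) Fx.norm_a (by push_cast; omega) Fx.path_tip.symm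
  refine Fb.tipOK.2 Fx.z t ?_ ?_ ?_ (hpath.mono fun v hv => ⟨hv.1, hcol v hv.2⟩)
  · exact Finset.mem_union_right _ (mem_trapDomain_Jabove.2 ⟨Fx.z_mem, hlt⟩)
  · omega
  · push_cast at ht ⊢; omega

/-- **Compatibility on the same side** (relative rotation `d = 0`): the exterior regions of two
fenced arms of complementary colours behind the same side are disjoint — the higher tip is more
than `8k` above the lower one (`row_gap_of_lt`), so the rows of the two regions separate. [cite: Nolin2008, §4.2 Def. 6–8 (arXiv 0711.4948)] -/
theorem compatible_same (hnM : n ≤ M) (hk₀ : 1 ≤ k₀) (hKM : ∀ j < K, 128 * (trapScale k₀ j : ℤ) < M)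
    {χo χc : SiteConfig (Site 2)} (hoc : ∀ v, v ∈ χc → v ∉ χo) (hco : ∀ v, v ∈ χo → v ∉ χc)
    (Fo : TrapFencedArm M n k₀ K χo) (Fc : TrapFencedArm M n k₀ K χc) :
    Disjoint Fo.extRegion Fc.extRegion := by
  have hne : Fo.z 1 ≠ Fc.z 1 := fun h => by
    have := eq_of_mem_trapO Fo.z_mem Fc.z_mem h
    exact hoc _ Fc.z_mem_config (this ▸ Fo.z_mem_config)
  rw [Set.disjoint_left]
  intro v hvo hvc
  rw [TrapFencedArm.mem_extRegion] at hvo hvc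
  rcases lt_or_gt_of_ne hne with hlt | hlt
  · have := row_gap_of_lt hnM hk₀ hKM hoc Fo Fc hlt
    have hk : (1 : ℤ) ≤ Fo.k := by exact_mod_cast one_le_trapScale hk₀ Fo.j
    omega
  · have := row_gap_of_lt hnM hk₀ hKM hco Fc Fo hlt
    have hk : (1 : ℤ) ≤ Fc.k := by exact_mod_cast one_le_trapScale hk₀ Fc.j
    omega

/-- **Compatibility with the next side counterclockwise** (relative rotation `d = 1`): let `Fb` be
a fenced arm of colour `χb` and `Fx` a fenced arm of the colour `χx = (rotConfig 1 χb)ᶜ` (the arm of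
the complementary colour read in the frame of the next side). Then `extRegion Fb` and the image
`ρ(extRegion Fx)` are disjoint. In the frame of `Fb` the other tip is `ρ(z_x) = (t, 2M - t)` on
side `1`; if it lies in the trapezoid (`t > M`) the protection of `Fb` keeps it out of the inner
box, i.e. `8k` columns west or `8k` rows away, and in all cases the explicit coordinates
`ρ(x, y) = (-y, x + y)` of the image region contradict those of `extRegion Fb` (whose exterior
sites lie beyond side `0` or side `1`). [cite: Nolin2008, §4.2 Def. 6–8 (arXiv 0711.4948)] -/
theorem compatible_adj (hnM : n ≤ M) (hk₀ : 1 ≤ k₀) (hKM : ∀ j < K, 128 * (trapScale k₀ j : ℤ) < M)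
    {χb χx : SiteConfig (Site 2)} (hrel : ∀ v, v ∈ χx ↔ triRotIsoPow 1 v ∉ χb)
    (Fb : TrapFencedArm M n k₀ K χb) (Fx : TrapFencedArm M n k₀ K χx) :
    Disjoint Fb.extRegion (triRotIsoPow 1 '' Fx.extRegion) := by
  have hzb := trapO_coord Fb.z_mem
  have hzx := trapO_coord Fx.z_mem
  have hkb1 : 1 ≤ trapScale k₀ Fb.j := one_le_trapScale hk₀ _
  have hkb : (Fb.k : ℤ) = trapScale k₀ Fb.j := rfl
  have hkx : (1 : ℤ) ≤ Fx.k := by exact_mod_cast one_le_trapScale hk₀ Fx.j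
  have hKb := hKM _ Fb.j_lt
  have hKx := hKM _ Fx.j_lt
  have hkx' : (Fx.k : ℤ) = trapScale k₀ Fx.j := rfl
  obtain ⟨-, -, hf0, hf1, -⟩ := rot_apply_formula Fx.z
  -- the other arm read in the frame of `Fb`: a `χbᶜ`-path of the annulus from `ρ z_x` to a far site
  have hpx : PathIn triGraph (triAnnSet n (2 * M) ∩ {v | v ∈ rotConfig 1 χb ↔ false}) Fx.a Fx.z :=
    Fx.path_tip.mono fun v hv => ⟨hv.1, by
      simp only [Set.mem_setOf_eq, mem_rotConfig, Bool.false_eq_true, iff_false]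
      exact (hrel v).1 hv.2⟩
  have hfar : PathIn triGraph (triAnnSet n (2 * M) ∩ χbᶜ) (triRotIsoPow 1 Fx.z) (triRotIsoPow 1 Fx.a) := by
    refine (pathIn_of_rotConfig 1 hpx).symm.mono ?_
    rintro w ⟨⟨v, hv, rfl⟩, hw⟩
    refine ⟨?_, by simpa using hw⟩
    rw [mem_triAnnSet] at hv ⊢
    rw [triNorm_rot]
    exact hv
  have hna : triNorm (triRotIsoPow 1 Fx.a) = n := by rw [triNorm_rot, Fx.norm_a]
  -- the claim: `ρ z_x` is far along side `1` (`t ≤ M`) or outside the inner box of `Fb`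
  have hclaim : -Fx.z 1 ≤ M ∨ ¬ (Fb.z 0 - 8 * Fb.k ≤ (triRotIsoPow 1 Fx.z) 0 ∧ (triRotIsoPow 1 Fx.z) 0 ≤ Fb.z 0 + 8 * Fb.k ∧
      Fb.z 1 - 8 * Fb.k ≤ (triRotIsoPow 1 Fx.z) 1 ∧ (triRotIsoPow 1 Fx.z) 1 ≤ Fb.z 1 + 8 * Fb.k) := by
    by_contra h
    rw [not_or, not_le, not_not] at h
    obtain ⟨ht, hin⟩ := h
    have hU : triRotIsoPow 1 Fx.z ∈ trapU M := by
      rw [mem_trapU, mem_trapD, hf0, hf1]; omega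
    have hin' := hin
    rw [hf0, hf1, hkb] at hin'
    obtain ⟨t, htout, hpath⟩ := exists_pathIn_trapD_exit (k := 8 * trapScale k₀ Fb.j) (s := triRotIsoPow 1 Fx.z)
      Fb.z_mem hnM (by push_cast; omega) hna (by rw [hf0, hf1]; push_cast; omega) hfar
    refine Fb.tipOK.2 (triRotIsoPow 1 Fx.z) t (Finset.mem_union_left _ hU) ?_ ?_ hpath
    · rw [hkb] at hin; exact hin
    · push_cast at htout ⊢; omega
  -- the coordinates of the two regions are incompatible
  rw [Set.disjoint_left]
  rintro v hv ⟨w, hw, rfl⟩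
  rw [TrapFencedArm.mem_extRegion] at hv hw
  obtain ⟨-, -, hw0, hw1, -⟩ := rot_apply_formula w
  obtain ⟨hvn, hv2, hv3, hv4, hv5⟩ := hv
  rw [triNorm_eq_max] at hvn
  simp only [lt_max_iff] at hvn
  rw [hf0, hf1] at hclaim
  rw [hw0, hw1] at *
  omega

/-- **Compatibility with a far side** (relative rotation `d ∈ {2, 3, 4}`): the exterior region of
a fenced arm and the image under `ρ^d` of the exterior region of another are disjoint — by the
explicit coordinates of `ρ^d`, the first lies within `2k + 1 < M` columns of `{v₀ = 2M}` while the
second has `v₀ ≤ 2k + 1`, `v₀ ≤ 0`, resp. `v₀ ≤ 2k + 1`. No relation between the colours is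
needed. [cite: Nolin2008, §4.2 Def. 6–8 (arXiv 0711.4948)] -/
theorem compatible_far (hk₀ : 1 ≤ k₀) (hKM : ∀ j < K, 128 * (trapScale k₀ j : ℤ) < M)
    {χb χx : SiteConfig (Site 2)} (Fb : TrapFencedArm M n k₀ K χb) (Fx : TrapFencedArm M n k₀ K χx)
    {d : ℕ} (hd : d = 2 ∨ d = 3 ∨ d = 4) : Disjoint Fb.extRegion (triRotIsoPow d '' Fx.extRegion) := by
  have hzb := trapO_coord Fb.z_mem
  have hzx := trapO_coord Fx.z_mem
  have hkb : (1 : ℤ) ≤ Fb.k := by exact_mod_cast one_le_trapScale hk₀ Fb.j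
  have hkx : (1 : ℤ) ≤ Fx.k := by exact_mod_cast one_le_trapScale hk₀ Fx.j
  have hKb := hKM _ Fb.j_lt
  have hKx := hKM _ Fx.j_lt
  have hkb' : (Fb.k : ℤ) = trapScale k₀ Fb.j := rfl
  have hkx' : (Fx.k : ℤ) = trapScale k₀ Fx.j := rfl
  rw [Set.disjoint_left]
  rintro v hv ⟨w, hw, rfl⟩
  rw [TrapFencedArm.mem_extRegion] at hv hw
  obtain ⟨-, -, -, -, h2, -, h3, -, h4, -, -, -⟩ := rot_apply_formula w
  rcases hd with rfl | rfl | rfl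
  · rw [h2] at hv; omega
  · rw [h3] at hv; omega
  · rw [h4] at hv; omega

/-- The relation between a rotated complementary colour and the base colour, from membership
lemmas: `v ∈ (rotConfig d χ₀)ᶜ ↔ ρ^d v ∉ χ₀`. [folklore] -/
theorem mem_compl_rotConfig_iff {d : ℕ} {χ₀ : SiteConfig (Site 2)} {v : Site 2} :
    v ∈ (rotConfig d χ₀)ᶜ ↔ triRotIsoPow d v ∉ χ₀ := by
  rw [Set.mem_compl_iff, mem_rotConfig]

/-- **Compatibility, all relative positions**: for a fenced arm `Fo` of colour `χ₀` (the open arm in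
its own frame) and a fenced arm `Fc` of the colour `χc` related to `χ₀` by
`v ∈ χc ↔ ρ^d v ∉ χ₀` (`d < 6`: the closed arm read in the frame `d` sides further counterclockwise),
`extRegion Fo` and `ρ^d(extRegion Fc)` are disjoint (`n ≤ M`, `128 k < M` for all scales). Cases
`d = 0` (`compatible_same`), `d = 1` (`compatible_adj`), `d = 5` (`compatible_adj` with the roles
of the two arms exchanged: the open arm is one side counterclockwise of the closed one), `d ∈ {2,3,4}`
(`compatible_far`). [cite: Nolin2008, §4.2 Def. 6–8 (arXiv 0711.4948)] -/
theorem disjoint_extRegion_core (hnM : n ≤ M) (hk₀ : 1 ≤ k₀) (hKM : ∀ j < K, 128 * (trapScale k₀ j : ℤ) < M)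
    {χ₀ χc : SiteConfig (Site 2)} {d : ℕ} (hd : d < 6) (hrel : ∀ v, v ∈ χc ↔ triRotIsoPow d v ∉ χ₀)
    (Fo : TrapFencedArm M n k₀ K χ₀) (Fc : TrapFencedArm M n k₀ K χc) :
    Disjoint Fo.extRegion (triRotIsoPow d '' Fc.extRegion) := by
  interval_cases d
  · -- same side
    have hrel' : ∀ v, v ∈ χc ↔ v ∉ χ₀ := fun v => by simpa using hrel v
    have himg : triRotIsoPow 0 '' Fc.extRegion = Fc.extRegion := by
      ext v; simp only [Set.mem_image, triRotIsoPow_zero_apply, exists_eq_right]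
    rw [himg]
    exact compatible_same hnM hk₀ hKM (fun v hv => (hrel' v).1 hv) (fun v hv hvc => (hrel' v).1 hvc hv) Fo Fc
  · -- next side counterclockwise
    exact compatible_adj hnM hk₀ hKM hrel Fo Fc
  · exact compatible_far hk₀ hKM Fo Fc (Or.inl rfl)
  · exact compatible_far hk₀ hKM Fo Fc (Or.inr (Or.inl rfl))
  · exact compatible_far hk₀ hKM Fo Fc (Or.inr (Or.inr rfl))
  · -- previous side: exchange the roles
    have hrel' : ∀ v, v ∈ χ₀ ↔ triRotIsoPow 1 v ∉ χc := by
      intro v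
      have h := hrel (triRotIsoPow 1 v)
      rw [← triRotIsoPow_add_apply, triRotIsoPow_six_apply] at h
      tauto
    have h := compatible_adj hnM hk₀ hKM hrel' Fc Fo
    rw [Set.disjoint_left] at h ⊢
    rintro v hv ⟨w, hw, rfl⟩
    refine h hw ⟨triRotIsoPow 5 w, hv, ?_⟩
    rw [← triRotIsoPow_add_apply, triRotIsoPow_six_apply]

/-- **Compatibility of the free spaces of the two arms** (the geometric input of the independent
extension of the two arms by the locally monotone FKG inequality, Nolin 2008, Lemma 13 and
Prop. 12 (i)): if the open arm is fenced in the frame `io` (`Fo : TrapFencedArm … (rotConfig io ω)`)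
and the closed arm in the frame `ic` (`Fc : TrapFencedArm … (rotConfig ic ω)ᶜ`), then back in the
original frame the exterior regions `ρ^{io}(extRegion Fo)` and `ρ^{ic}(extRegion Fc)` — which contain
the corner boxes of the two fences and the exterior parts of the two fence zones — are disjoint
sets of sites outside `Λ_{2M}` (`io < 6`, `n ≤ M`, `128 k < M` for all scales). [cite: Nolin2008, §4.2 Def. 6–8 and §4.3 Prop. 12 (arXiv 0711.4948: Prop. 11)] -/
theorem disjoint_extRegion_image (hnM : n ≤ M) (hk₀ : 1 ≤ k₀) (hKM : ∀ j < K, 128 * (trapScale k₀ j : ℤ) < M)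
    {ω : SiteConfig (Site 2)} {io ic : ℕ} (hio : io < 6)
    (Fo : TrapFencedArm M n k₀ K (rotConfig io ω)) (Fc : TrapFencedArm M n k₀ K (rotConfig ic ω)ᶜ) :
    Disjoint (triRotIsoPow io '' Fo.extRegion) (triRotIsoPow ic '' Fc.extRegion) := by
  -- the relative rotation
  set d := (ic + (6 - io)) % 6 with hd
  have hd6 : d < 6 := Nat.mod_lt _ (by norm_num)
  have hcomp : ∀ v : Site 2, triRotIsoPow io (triRotIsoPow d v) = triRotIsoPow ic v := by
    intro v
    rw [hd, triRotIsoPow_mod_six_apply, ← triRotIsoPow_add_apply,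
      show ic + (6 - io) + io = ic + 6 by omega, triRotIsoPow_add_six_apply]
  have hrel : ∀ v, v ∈ (rotConfig ic ω)ᶜ ↔ triRotIsoPow d v ∉ rotConfig io ω := by
    intro v
    rw [Set.mem_compl_iff, mem_rotConfig, mem_rotConfig, hcomp]
  have hcore := disjoint_extRegion_core hnM hk₀ hKM hd6 hrel Fo Fc
  rw [Set.disjoint_left] at hcore ⊢
  rintro x ⟨v, hv, rfl⟩ ⟨w, hw, hwv⟩
  rw [← hcomp w] at hwv
  have hinj : triRotIsoPow d w = v := (triRotIsoPow io).injective hwv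
  exact hcore hv ⟨w, hw, hinj⟩

end Compatibility

end Literature.Probability.Percolation
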